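import Literature.GroupTheory.ProfiniteConjugateIndex
import Mathlib.GroupTheory.OrderOfElement

/-!
# Pro-cyclic (monothetic) closed subgroups: an open subgroup is determined by its index

Sequel of `Literature.GroupTheory.ProfiniteConjugateIndex`.  For `A = \overline{⟨a⟩}` the closure of a
cyclic subgroup of a Hausdorff topological group (e.g. a cusp-inertia group `≅ Ẑ(1)` or a pro-`Σ`
quotient of it inside a profinite fundamental group):

* `pow_relIndex_mem_of_le_closure_zpowers` — `a ^ [A : H] ∈ H` (`A` is abelian);
* `closure_zpowers_subset_iUnion_smul` — `A ⊆ ⋃_{i<n} aⁱ · (A ∩ \overline{⟨aⁿ⟩})`;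
* `eq_inf_closure_zpowers_pow_of_le` — a closed subgroup `H ≤ A` of finite index `n` IS `A ∩ \overline{⟨aⁿ⟩}`;
* `eq_of_relIndex_eq_of_le_closure_zpowers` — hence `A` has at most ONE closed subgroup of each finite
  index;
* `conj_smul_inf_eq_self_of_closure_zpowers`, `mem_normalizer_inf_of_mem_commensurator_closure_zpowers` —
  in a profinite group, an element commensurating `A` NORMALISES `A ∩ gAg⁻¹` (combine with
  `ProfiniteConjugateIndex.conj_smul_inf_eq_self_of_unique_index`): the commensurator of a pro-cyclic
  closed subgroup is the union of the normalisers of its open subgroups — the reduction step for the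
  commensurable terminality of cusp-inertia / edge subgroups ([SemiAnbd] Rmk 2.10.1 p. 32, [AbsTopI]
  Lem 4.5 (vi)).

Classical / folklore (cf. Ribes–Zalesskii, *Profinite Groups*, 2nd ed. 2010, §2.1 and Thm 2.7.2 for
pro-cyclic groups); Mathlib-only; nothing here bears on [IUTchIII] Cor. 3.12.
-/

open scoped Pointwise

namespace Literature.GroupTheory

namespace ProfiniteConjugateIndex

variable {G : Type*} [Group G]


/-- Conjugates of a closed subgroup are closed (conjugation is a homeomorphism). [folklore] -/
private theorem isClosed_conj_smul' [TopologicalSpace G] [IsTopologicalGroup G] (A : Subgroup G)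
    (hA : IsClosed (A : Set G)) (g : ConjAct G) : IsClosed ((g • A : Subgroup G) : Set G) := by
  have hset : ((g • A : Subgroup G) : Set G) =
      (fun x : G => (ConjAct.ofConjAct g)⁻¹ * x * (ConjAct.ofConjAct g)⁻¹⁻¹) ⁻¹' (A : Set G) := by
    ext x
    simp only [SetLike.mem_coe, Set.mem_preimage, Subgroup.mem_pointwise_smul_iff_inv_smul_mem,
      ConjAct.smul_def, ConjAct.ofConjAct_inv]
  rw [hset]
  exact hA.preimage ((continuous_const.mul continuous_id).mul continuous_const)

/-! ### Pro-cyclic (monothetic) closed subgroups: an open subgroup is determined by its index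

For `A = \overline{⟨a⟩}` the closure of a cyclic subgroup (e.g. a cusp-inertia group `≅ Ẑ(1)` or its
pro-`Σ` quotients), a closed subgroup `H ≤ A` of finite index `n` is `A ∩ \overline{⟨aⁿ⟩}`; hence `A` has
at most one closed subgroup of each finite index, and `conj_smul_inf_eq_self_of_unique_index` applies. -/

section Monothetic

variable [TopologicalSpace G] [IsTopologicalGroup G] [T2Space G]

/-- For `A = \overline{⟨a⟩}` and `H ≤ A` of finite index, `a ^ [A : H] ∈ H` (`A` is abelian, so `H` is
normal in `A` and Lagrange applies in `A/H`). [cite: DixonEtAl1999, Definition 1.27, Proposition 1.26 (iii), Exercise 1.7 (ii)] -/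
theorem pow_relIndex_mem_of_le_closure_zpowers (a : G) (H : Subgroup G) :
    a ^ H.relIndex (Subgroup.zpowers a).topologicalClosure ∈ H := by
  set A : Subgroup G := (Subgroup.zpowers a).topologicalClosure with hAdef
  have hcomm : ∀ x y : A, x * y = y * x := by
    letI : CommGroup A :=
      Subgroup.commGroupTopologicalClosure _ (fun x y => IsMulCommutative.is_comm.comm x y)
    exact fun x y => mul_comm x y
  haveI : IsMulCommutative A := ⟨⟨hcomm⟩⟩
  have ha : a ∈ A := Subgroup.le_topologicalClosure _ (Subgroup.mem_zpowers a)
  have hmem := Subgroup.pow_index_mem (H.subgroupOf A) ⟨a, ha⟩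
  rw [Subgroup.mem_subgroupOf, Subgroup.coe_pow] at hmem
  exact hmem

/-- The subgroup `A ∩ \overline{⟨aⁿ⟩}` of `A = \overline{⟨a⟩}` used to pin down index-`n` subgroups.
[cite: DixonEtAl1999, Definition 1.27, Proposition 1.26 (iii), Exercise 1.7 (ii)] -/
theorem inf_closure_zpowers_pow_le (a : G) {H : Subgroup G} (hHc : IsClosed (H : Set G)) :
    (Subgroup.zpowers a).topologicalClosure ⊓
        (Subgroup.zpowers (a ^ H.relIndex (Subgroup.zpowers a).topologicalClosure)).topologicalClosure
      ≤ H :=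
  inf_le_right.trans
    (Subgroup.topologicalClosure_minimal _
      ((Subgroup.zpowers_le).mpr (pow_relIndex_mem_of_le_closure_zpowers a H)) hHc)

omit [T2Space G] in
/-- **Covering**: `\overline{⟨a⟩} ⊆ ⋃_{i<n} aⁱ · (\overline{⟨a⟩} ∩ \overline{⟨aⁿ⟩})` for `n ≠ 0` (the right
side is a finite union of closed sets containing `⟨a⟩`). [cite: DixonEtAl1999, Definition 1.27, Proposition 1.26 (iii), Exercise 1.7 (ii)] -/
theorem closure_zpowers_subset_iUnion_smul (a : G) {n : ℕ} (hn : n ≠ 0) :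
    ((Subgroup.zpowers a).topologicalClosure : Set G) ⊆
      ⋃ i ∈ Finset.range n, (a ^ i) • (((Subgroup.zpowers a).topologicalClosure ⊓
        (Subgroup.zpowers (a ^ n)).topologicalClosure : Subgroup G) : Set G) := by
  set A : Subgroup G := (Subgroup.zpowers a).topologicalClosure with hAdef
  set H₀ : Subgroup G := A ⊓ (Subgroup.zpowers (a ^ n)).topologicalClosure with hH₀def
  have hH₀c : IsClosed (H₀ : Set G) := by
    rw [hH₀def, Subgroup.coe_inf]
    exact (Subgroup.isClosed_topologicalClosure _).inter (Subgroup.isClosed_topologicalClosure _)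
  have hclosed : IsClosed (⋃ i ∈ Finset.range n, (a ^ i) • (H₀ : Set G)) := by
    refine Set.Finite.isClosed_biUnion (Finset.finite_toSet _) fun i _ => ?_
    exact hH₀c.smul (a ^ i)
  rw [hAdef, Subgroup.topologicalClosure_coe]
  refine closure_minimal ?_ hclosed
  intro x hx
  obtain ⟨k, rfl⟩ := Subgroup.mem_zpowers_iff.mp hx
  -- Euclidean division `k = n * q + r`, `0 ≤ r < n`
  have hn' : (0 : ℤ) < (n : ℤ) := by exact_mod_cast Nat.pos_of_ne_zero hn
  set q : ℤ := k / (n : ℤ) with hq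
  set r : ℤ := k % (n : ℤ) with hr
  have hr0 : 0 ≤ r := Int.emod_nonneg _ hn'.ne'
  have hrn : r < (n : ℤ) := Int.emod_lt_of_pos _ hn'
  have hk : k = (n : ℤ) * q + r := (Int.mul_ediv_add_emod k (n : ℤ)).symm
  refine Set.mem_iUnion₂.mpr ⟨r.toNat, ?_, ?_⟩
  · rw [Finset.mem_range]
    have : ((r.toNat : ℕ) : ℤ) < (n : ℤ) := by rwa [Int.toNat_of_nonneg hr0]
    exact_mod_cast this
  · rw [Set.mem_smul_set_iff_inv_smul_mem, smul_eq_mul]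
    have hai : (a ^ r.toNat : G) = a ^ r := by
      rw [← zpow_natCast, Int.toNat_of_nonneg hr0]
    have hcalc : (a ^ r.toNat)⁻¹ * a ^ k = (a ^ (n : ℤ)) ^ q := by
      rw [hai, ← zpow_neg, ← zpow_add, hk, ← zpow_mul]
      congr 1
      ring
    rw [hcalc, SetLike.mem_coe, hH₀def, zpow_natCast]
    refine Subgroup.mem_inf.mpr ⟨?_, ?_⟩
    · exact Subgroup.le_topologicalClosure _ (Subgroup.zpow_mem _ (Subgroup.mem_zpowers_iff.mpr ⟨n, by simp⟩) q)
    · exact Subgroup.le_topologicalClosure _ (Subgroup.zpow_mem _ (Subgroup.mem_zpowers _) q)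

omit [T2Space G] in
/-- The index of `A ∩ \overline{⟨aⁿ⟩}` in `A = \overline{⟨a⟩}` is finite and at most `n` (for `n ≠ 0`).
[cite: DixonEtAl1999, Definition 1.27, Proposition 1.26 (iii), Exercise 1.7 (ii)] -/
theorem relIndex_inf_closure_zpowers_pow_le (a : G) {n : ℕ} (hn : n ≠ 0) :
    ((Subgroup.zpowers a).topologicalClosure ⊓
        (Subgroup.zpowers (a ^ n)).topologicalClosure).relIndex (Subgroup.zpowers a).topologicalClosure ≤ n ∧
    ((Subgroup.zpowers a).topologicalClosure ⊓
        (Subgroup.zpowers (a ^ n)).topologicalClosure).relIndex (Subgroup.zpowers a).topologicalClosure ≠ 0 := by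
  set A : Subgroup G := (Subgroup.zpowers a).topologicalClosure with hAdef
  set H₀ : Subgroup G := A ⊓ (Subgroup.zpowers (a ^ n)).topologicalClosure with hH₀def
  have ha : a ∈ A := Subgroup.le_topologicalClosure _ (Subgroup.mem_zpowers a)
  have hcover := closure_zpowers_subset_iUnion_smul a hn
  -- the map `Fin n → A ⧸ (H₀ ∩ A)`, `i ↦ [aⁱ]`, is onto
  let f : Fin n → A ⧸ H₀.subgroupOf A := fun i => QuotientGroup.mk ⟨a ^ (i : ℕ), A.pow_mem ha _⟩
  have hf : Function.Surjective f := by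
    intro y
    obtain ⟨x, rfl⟩ := QuotientGroup.mk_surjective y
    have hx := hcover x.2
    obtain ⟨i, hi, hxi⟩ := Set.mem_iUnion₂.mp hx
    rw [Finset.mem_range] at hi
    refine ⟨⟨i, hi⟩, ?_⟩
    rw [Set.mem_smul_set_iff_inv_smul_mem, smul_eq_mul, SetLike.mem_coe] at hxi
    refine QuotientGroup.eq.mpr ?_
    rw [Subgroup.mem_subgroupOf]
    simpa [hH₀def, Subgroup.mem_inf] using hxi
  have hfin : Finite (A ⧸ H₀.subgroupOf A) := Finite.of_surjective f hf
  refine ⟨?_, ?_⟩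
  · have := Nat.card_le_card_of_surjective f hf
    simpa [Subgroup.relIndex, Subgroup.index] using this
  · exact Subgroup.index_ne_zero_of_finite

/-- **A closed subgroup of finite index `n` in `A = \overline{⟨a⟩}` is `A ∩ \overline{⟨aⁿ⟩}`.** [cite: DixonEtAl1999, Definition 1.27, Proposition 1.26 (iii), Exercise 1.7 (ii)] -/
theorem eq_inf_closure_zpowers_pow_of_le (a : G) {H : Subgroup G} (hHc : IsClosed (H : Set G))
    (hH : H ≤ (Subgroup.zpowers a).topologicalClosure)
    (hn : H.relIndex (Subgroup.zpowers a).topologicalClosure ≠ 0) :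
    H = (Subgroup.zpowers a).topologicalClosure ⊓
      (Subgroup.zpowers (a ^ H.relIndex (Subgroup.zpowers a).topologicalClosure)).topologicalClosure := by
  set A : Subgroup G := (Subgroup.zpowers a).topologicalClosure with hAdef
  set n : ℕ := H.relIndex A with hndef
  set H₀ : Subgroup G := A ⊓ (Subgroup.zpowers (a ^ n)).topologicalClosure with hH₀def
  have hle : H₀ ≤ H := inf_closure_zpowers_pow_le a hHc
  obtain ⟨hH₀le, hH₀ne⟩ := relIndex_inf_closure_zpowers_pow_le a hn
  -- `[A : H₀] = [H : H₀]·[A : H] ≤ [A : H]` forces `[H : H₀] = 1`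
  have hmul := Subgroup.relIndex_mul_relIndex H₀ H A hle hH
  have h0 : H₀.relIndex H ≠ 0 := by
    intro h0
    rw [h0, zero_mul] at hmul
    exact hH₀ne hmul.symm
  have h1 : H₀.relIndex H = 1 := by
    have hle' : H₀.relIndex H * n ≤ 1 * n := by rw [one_mul, hmul]; exact hH₀le
    have := Nat.le_of_mul_le_mul_right hle' (Nat.pos_of_ne_zero hn)
    omega
  exact le_antisymm (Subgroup.relIndex_eq_one.mp h1) hle

/-- **Uniqueness**: `A = \overline{⟨a⟩}` has at most ONE closed subgroup of each finite index. [cite: DixonEtAl1999, Definition 1.27, Proposition 1.26 (iii), Exercise 1.7 (ii)] -/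
theorem eq_of_relIndex_eq_of_le_closure_zpowers (a : G) {H K : Subgroup G}
    (hHc : IsClosed (H : Set G)) (hKc : IsClosed (K : Set G))
    (hH : H ≤ (Subgroup.zpowers a).topologicalClosure) (hK : K ≤ (Subgroup.zpowers a).topologicalClosure)
    (h : H.relIndex (Subgroup.zpowers a).topologicalClosure =
      K.relIndex (Subgroup.zpowers a).topologicalClosure)
    (hn : H.relIndex (Subgroup.zpowers a).topologicalClosure ≠ 0) : H = K := by
  rw [eq_inf_closure_zpowers_pow_of_le a hHc hH hn, eq_inf_closure_zpowers_pow_of_le a hKc hK (h ▸ hn), h]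

end Monothetic

/-! ### In a profinite group -/

section Profinite

variable [TopologicalSpace G] [IsTopologicalGroup G] [CompactSpace G] [TotallyDisconnectedSpace G]
  [T2Space G]

/-- **Commensurating a pro-cyclic closed subgroup forces normalising a finite-index piece**: for
`A = \overline{⟨a⟩}` in a profinite group and `g` with `[A : A ∩ gAg⁻¹]` finite, `g` normalises
`A ∩ gAg⁻¹`.  (Reduction step for commensurable terminality of cusp-inertia / edge groups.) [cite: MochizukiSemiAnbd2006, Remark 2.10.1 p.32 (PRIMS 42 p.255)] -/
theorem conj_smul_inf_eq_self_of_closure_zpowers (a : G) (g : ConjAct G)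
    (h : ((Subgroup.zpowers a).topologicalClosure ⊓ g • (Subgroup.zpowers a).topologicalClosure).relIndex
      (Subgroup.zpowers a).topologicalClosure ≠ 0) :
    g • ((Subgroup.zpowers a).topologicalClosure ⊓ g • (Subgroup.zpowers a).topologicalClosure) =
      (Subgroup.zpowers a).topologicalClosure ⊓ g • (Subgroup.zpowers a).topologicalClosure := by
  set A : Subgroup G := (Subgroup.zpowers a).topologicalClosure with hAdef
  have hA : IsClosed (A : Set G) := Subgroup.isClosed_topologicalClosure _
  have hB : IsClosed ((A ⊓ g • A : Subgroup G) : Set G) := by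
    rw [Subgroup.coe_inf]; exact hA.inter (isClosed_conj_smul' A hA g)
  refine conj_smul_inf_eq_self_of_unique_index A hA g fun H hHA hHc hidx => ?_
  exact eq_of_relIndex_eq_of_le_closure_zpowers a hHc hB hHA inf_le_left hidx (hidx ▸ h)

/-- The same in commensurator language: an element of the commensurator of the pro-cyclic closed subgroup
`A = \overline{⟨a⟩}` normalises `A ∩ gAg⁻¹`. [cite: MochizukiSemiAnbd2006, Remark 2.10.1 p.32 (PRIMS 42 p.255)] -/
theorem mem_normalizer_inf_of_mem_commensurator_closure_zpowers (a : G) (g : G)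
    (hg : g ∈ Subgroup.Commensurable.commensurator (Subgroup.zpowers a).topologicalClosure) :
    ConjAct.toConjAct g • ((Subgroup.zpowers a).topologicalClosure ⊓
        ConjAct.toConjAct g • (Subgroup.zpowers a).topologicalClosure) =
      (Subgroup.zpowers a).topologicalClosure ⊓
        ConjAct.toConjAct g • (Subgroup.zpowers a).topologicalClosure := by
  have hA : IsClosed (((Subgroup.zpowers a).topologicalClosure : Subgroup G) : Set G) :=
    Subgroup.isClosed_topologicalClosure _
  exact conj_smul_inf_eq_self_of_closure_zpowers a _
    ((mem_commensurator_iff_relIndex_ne_zero _ hA g).mp hg)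

end Profinite

end ProfiniteConjugateIndex

end Literature.GroupTheory
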